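import Summits.CriticalPhenomena.PercolationContinuityZ3.Theorems.PercNearOneGluingNoHeavyLowerTailAPLShortcutParallel
import Summits.CriticalPhenomena.PercolationContinuityZ3.Theorems.PercNearOneGluingNoHeavyLowerTailAPLBeadChain
import HarnessLib

/-!
# `NoHeavyLowerTail` (stmt-CriticalPhenomena-4575) — `E ≤ 28/27` FOR A BEAD CHAIN WITH AN ARBITRARY APEX-FREE BYPASS (bond percolation)

Support file (prover prim-ineq-gen-8 gen 59; `--supports stmt-CriticalPhenomena-4575`; memo
run/shared/lean/prim/prim-ineq-gen-8/FINDING-gen59-WEAKFACE.md §0(3)).  No definitions, no named facts, no sorries.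

The first kernel theorem of the `E`-route beyond `E ≤ 1`: combine the bead-chain theorem (`beadChain_E_le_one`: `E ≤ 1` when the ports are joined
by a unique path in `G∖o`, arbitrary beads with apex edges) with `shortcut_parallel` (parallel composition with an apex-free two-terminal network
preserves `E ≤ 28/27`).  Result (`beadChainBypass_E_le_prodBernoulli`): for `μ = prodBernoulli w` on the pairs of a finite vertex type, apex `o`,
string `y 0 — ⋯ — y n` with beads `S k` (as in `…APLBeadChain.lean`) and an additional edge set `B` (the BYPASS) which avoids the apex, is
disjoint from the bead-chain edges and meets them only at the ports `y 0, y n`: if every positive-weight pair is a string edge, in a bead, or in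
`B`, then `(μ(o↔u ∩ o↔v) − μ(o↔u)μ(o↔v))² ≤ (28/27)·μ(o↔u)·μ(o↔v)·μ((o↔u)ᶜ ∩ u↔v)` with `u = y 0`, `v = y n`.  Examples: the apex over a cycle
through `u, v` with apex edges into one of the two arcs only (plus beads hung anywhere on that arc), the apex over a theta graph with apex edges on
one route.  The constant `28/27` is the sharp constant of the parallel step in the weak-apex limit (`shortcut_first_order_sharp`). [this work]
-/

namespace Summit.CriticalPhenomena.PercolationContinuityZ3.Theorems

namespace APL

open MeasureTheory Literature.Probability.Percolation Literature.Probability.Percolation.Gladkov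
  Literature.Probability.Percolation.DecisionTree Literature.Probability.LatticeModels
open scoped Classical

variable {V : Type*} [Fintype V]

/-- **`E ≤ 28/27` for a bead chain with an apex-free bypass** (`PrW` form): hypotheses of `beadChain_E_le_one` for the string `y`, beads `S`, plus an
edge set `B` with no edge containing `o`, disjoint from the bead-chain edge set `F` and meeting it only at `o, y 0, y n`; conclusion `E ≤ 28/27` for
`(o; y 0, y n)` on `F ∪ B`. [this work] -/
theorem beadChainBypass_E_le (o : V) (y : ℕ → V) (S : ℕ → Finset (Sym2 V)) (B : Finset (Sym2 V))
    (p : Sym2 V → ℝ) (hp0 : ∀ e, 0 ≤ p e) (hp1 : ∀ e, p e ≤ 1) (n : ℕ)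
    (hy : ∀ i j, i ≤ n → j ≤ n → y i = y j → i = j) (hyo : ∀ i, i ≤ n → y i ≠ o)
    (hSS : ∀ i j, i ≤ n → j ≤ n → i ≠ j → Disjoint (S i) (S j))
    (hSo : ∀ i j, i ≤ n → j ≤ n → i ≠ j → ∀ z : V, (∃ e ∈ S i, z ∈ e) → (∃ e ∈ S j, z ∈ e) → z = o)
    (hSy : ∀ i j, i ≤ n → j ≤ n → (∃ e ∈ S i, y j ∈ e) → i = j)
    (hBo : ∀ e ∈ B, o ∉ e)
    (hBF : Disjoint ((Finset.range (n + 1)).biUnion S ∪ (Finset.range n).image (fun k => s(y k, y (k + 1)))) B)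
    (hBsep : ∀ z : V, (∃ e ∈ (Finset.range (n + 1)).biUnion S ∪ (Finset.range n).image (fun k => s(y k, y (k + 1))), z ∈ e) →
      (∃ e ∈ B, z ∈ e) → (z = o ∨ z = y 0 ∨ z = y n)) :
    (PrW ((Finset.range (n + 1)).biUnion S ∪ (Finset.range n).image (fun k => s(y k, y (k + 1))) ∪ B) p
          {K : Finset (Sym2 V) | y 0 ∈ cl K o ∧ y n ∈ cl K o}
        - PrW ((Finset.range (n + 1)).biUnion S ∪ (Finset.range n).image (fun k => s(y k, y (k + 1))) ∪ B) p
            {K : Finset (Sym2 V) | y 0 ∈ cl K o}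
          * PrW ((Finset.range (n + 1)).biUnion S ∪ (Finset.range n).image (fun k => s(y k, y (k + 1))) ∪ B) p
            {K : Finset (Sym2 V) | y n ∈ cl K o}) ^ 2
      ≤ 28 / 27 * PrW ((Finset.range (n + 1)).biUnion S ∪ (Finset.range n).image (fun k => s(y k, y (k + 1))) ∪ B) p
            {K : Finset (Sym2 V) | y 0 ∈ cl K o}
        * PrW ((Finset.range (n + 1)).biUnion S ∪ (Finset.range n).image (fun k => s(y k, y (k + 1))) ∪ B) p
            {K : Finset (Sym2 V) | y n ∈ cl K o}
        * PrW ((Finset.range (n + 1)).biUnion S ∪ (Finset.range n).image (fun k => s(y k, y (k + 1))) ∪ B) p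
            {K : Finset (Sym2 V) | y 0 ∉ cl K o ∧ y n ∈ cl K (y 0)} := by
  set F := (Finset.range (n + 1)).biUnion S ∪ (Finset.range n).image (fun k => s(y k, y (k + 1))) with hFdef
  have h1 := beadChain_E_le_one o y S p hp0 hp1 n hy hyo hSS hSo hSy
  rw [← hFdef] at h1
  have hX : 0 ≤ PrW F p {K : Finset (Sym2 V) | y 0 ∈ cl K o} := PrW_nonneg F hp0 hp1 _
  have hY : 0 ≤ PrW F p {K : Finset (Sym2 V) | y n ∈ cl K o} := PrW_nonneg F hp0 hp1 _
  have hZ : 0 ≤ PrW F p {K : Finset (Sym2 V) | y 0 ∉ cl K o ∧ y n ∈ cl K (y 0)} := PrW_nonneg F hp0 hp1 _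
  have hE : (PrW F p {K : Finset (Sym2 V) | y 0 ∈ cl K o ∧ y n ∈ cl K o}
        - PrW F p {K : Finset (Sym2 V) | y 0 ∈ cl K o} * PrW F p {K : Finset (Sym2 V) | y n ∈ cl K o}) ^ 2
        ≤ 28 / 27 * PrW F p {K : Finset (Sym2 V) | y 0 ∈ cl K o} * PrW F p {K : Finset (Sym2 V) | y n ∈ cl K o}
          * PrW F p {K : Finset (Sym2 V) | y 0 ∉ cl K o ∧ y n ∈ cl K (y 0)} :=
    h1.trans (by nlinarith [mul_nonneg (mul_nonneg hX hY) hZ])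
  exact shortcut_parallel p hp0 hp1 F B hBF o (y 0) (y n) hBsep hBo (hyo 0 (Nat.zero_le n)) (hyo n le_rfl) hE

/-- **`E ≤ 28/27` FOR A BEAD CHAIN WITH AN APEX-FREE BYPASS, for bond percolation** (`μ = prodBernoulli w` on the pairs of a finite vertex type).
Apex `o`; string `y 0 — ⋯ — y n` (pairwise distinct, `≠ o`); beads `S 0, …, S n` (pairwise disjoint, two beads share no vertex but `o`, `y j` meets
only `S j`); bypass `B`: an edge set avoiding `o`, disjoint from the string/bead edges and sharing with them only the vertices `o, y 0, y n`; every pair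
of positive weight is a string edge, in a bead, or in `B`.  Then with `u = y 0`, `v = y n`:
`(μ(o↔u ∩ o↔v) − μ(o↔u)μ(o↔v))² ≤ (28/27)·μ(o↔u)·μ(o↔v)·μ((o↔u)ᶜ ∩ u↔v)`. [this work] -/
theorem beadChainBypass_E_le_prodBernoulli (w : Sym2 V → unitInterval) (o : V) (y : ℕ → V) (S : ℕ → Finset (Sym2 V))
    (B : Finset (Sym2 V)) (n : ℕ)
    (hy : ∀ i j, i ≤ n → j ≤ n → y i = y j → i = j) (hyo : ∀ i, i ≤ n → y i ≠ o)
    (hSS : ∀ i j, i ≤ n → j ≤ n → i ≠ j → Disjoint (S i) (S j))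
    (hSo : ∀ i j, i ≤ n → j ≤ n → i ≠ j → ∀ z : V, (∃ e ∈ S i, z ∈ e) → (∃ e ∈ S j, z ∈ e) → z = o)
    (hSy : ∀ i j, i ≤ n → j ≤ n → (∃ e ∈ S i, y j ∈ e) → i = j)
    (hBo : ∀ e ∈ B, o ∉ e)
    (hBF : Disjoint ((Finset.range (n + 1)).biUnion S ∪ (Finset.range n).image (fun k => s(y k, y (k + 1)))) B)
    (hBsep : ∀ z : V, (∃ e ∈ (Finset.range (n + 1)).biUnion S ∪ (Finset.range n).image (fun k => s(y k, y (k + 1))), z ∈ e) →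
      (∃ e ∈ B, z ∈ e) → (z = o ∨ z = y 0 ∨ z = y n))
    (hw : ∀ e : Sym2 V, 0 < (w e : ℝ) →
      e ∈ (Finset.range (n + 1)).biUnion S ∪ (Finset.range n).image (fun k => s(y k, y (k + 1))) ∪ B) :
    ((Literature.Probability.LatticeModels.prodBernoulli w).real
          ((openConn o (y 0) : Set (BondConfig V)) ∩ (openConn o (y n) : Set (BondConfig V)))
        - (Literature.Probability.LatticeModels.prodBernoulli w).real (openConn o (y 0) : Set (BondConfig V))
          * (Literature.Probability.LatticeModels.prodBernoulli w).real (openConn o (y n) : Set (BondConfig V))) ^ 2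
      ≤ 28 / 27 * (Literature.Probability.LatticeModels.prodBernoulli w).real (openConn o (y 0) : Set (BondConfig V))
        * (Literature.Probability.LatticeModels.prodBernoulli w).real (openConn o (y n) : Set (BondConfig V))
        * (Literature.Probability.LatticeModels.prodBernoulli w).real
          ((openConn o (y 0) : Set (BondConfig V))ᶜ ∩ (openConn (y 0) (y n) : Set (BondConfig V))) := by
  have hcl : ∀ (T : Finset (Sym2 V)) (a b : V), (↑T : Set (Sym2 V)) ∈ openConn a b ↔ b ∈ cl T a :=
    fun T a b => by rw [mem_cl]; rfl
  set F' := (Finset.range (n + 1)).biUnion S ∪ (Finset.range n).image (fun k => s(y k, y (k + 1))) ∪ B with hFdef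
  have hp0 : ∀ e, 0 ≤ (fun e => (w e : ℝ)) e := fun e => (w e).2.1
  have hp1 : ∀ e, (fun e => (w e : ℝ)) e ≤ 1 := fun e => (w e).2.2
  have hsupp : ∀ X : Set (Finset (Sym2 V)), PrW Finset.univ (fun e => (w e : ℝ)) X = PrW F' (fun e => (w e : ℝ)) X :=
    fun X => PrW_of_support (fun e => (w e : ℝ)) (Finset.subset_univ F') (fun e _ heF => by
      by_contra hne
      exact heF (hw e (lt_of_le_of_ne (w e).2.1 (Ne.symm hne)))) X
  have cτ : (Literature.Probability.LatticeModels.prodBernoulli w).real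
      ((openConn o (y 0) : Set (BondConfig V)) ∩ (openConn o (y n) : Set (BondConfig V)))
      = PrW F' (fun e => (w e : ℝ)) {K : Finset (Sym2 V) | y 0 ∈ cl K o ∧ y n ∈ cl K o} := by
    rw [prodBernoulli_real_eq_PrW_univ w (X := {K : Finset (Sym2 V) | y 0 ∈ cl K o ∧ y n ∈ cl K o}) fun T => by
      simp only [Set.mem_setOf_eq, Set.mem_inter_iff, hcl], hsupp]
  have cp : (Literature.Probability.LatticeModels.prodBernoulli w).real (openConn o (y 0) : Set (BondConfig V))
      = PrW F' (fun e => (w e : ℝ)) {K : Finset (Sym2 V) | y 0 ∈ cl K o} := by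
    rw [prodBernoulli_real_eq_PrW_univ w (X := {K : Finset (Sym2 V) | y 0 ∈ cl K o}) fun T => by
      simp only [Set.mem_setOf_eq, hcl], hsupp]
  have cπ : (Literature.Probability.LatticeModels.prodBernoulli w).real (openConn o (y n) : Set (BondConfig V))
      = PrW F' (fun e => (w e : ℝ)) {K : Finset (Sym2 V) | y n ∈ cl K o} := by
    rw [prodBernoulli_real_eq_PrW_univ w (X := {K : Finset (Sym2 V) | y n ∈ cl K o}) fun T => by
      simp only [Set.mem_setOf_eq, hcl], hsupp]
  have cm : (Literature.Probability.LatticeModels.prodBernoulli w).real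
      ((openConn o (y 0) : Set (BondConfig V))ᶜ ∩ (openConn (y 0) (y n) : Set (BondConfig V)))
      = PrW F' (fun e => (w e : ℝ)) {K : Finset (Sym2 V) | y 0 ∉ cl K o ∧ y n ∈ cl K (y 0)} := by
    rw [prodBernoulli_real_eq_PrW_univ w (X := {K : Finset (Sym2 V) | y 0 ∉ cl K o ∧ y n ∈ cl K (y 0)}) fun T => by
      simp only [Set.mem_setOf_eq, Set.mem_inter_iff, Set.mem_compl_iff, hcl], hsupp]
  rw [cτ, cp, cπ, cm]
  exact beadChainBypass_E_le o y S B (fun e => (w e : ℝ)) hp0 hp1 n hy hyo hSS hSo hSy hBo hBF hBsep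

end APL

end Summit.CriticalPhenomena.PercolationContinuityZ3.Theorems
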